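import Summits.AtomisticToContinuum.Crystallization.Theses.PRVarianceCertificate
import Summits.AtomisticToContinuum.Crystallization.Theorems.LayeredLawsSelectHcp.Negative.Threshold
import Summits.AtomisticToContinuum.Crystallization.Theorems.PRVarianceCertificateGroundStateVarianceCertificateStubVirialSite
import Summits.AtomisticToContinuum.Crystallization.Theorems.PRVarianceCertificateGroundStateVarianceCertificateStubSmallClusters
import Summits.AtomisticToContinuum.Crystallization.Theorems.PRVarianceCertificateGroundStateVarianceCertificateAttainment
import Summits.AtomisticToContinuum.Crystallization.Theorems.PRVarianceCertificateGroundStateVarianceCertificateCauchySchwarz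

/-!
# Crux `GroundStateVarianceCertificate` (stmt-AtomisticToContinuum-11859) — line `registered`
# (= BC3 birth skeleton), lead's reshape v2; v3 (lead c2, 2026-08-17): stubs 2a, 2b CLOSED

v3 (lead c2): `stub_virialSite` and `stub_smallClusters` are LANDED (tree files
`Theorems/PRVarianceCertificateGroundStateVarianceCertificateStubVirialSite.lean`, p146341, and
`…StubSmallClusters.lean`, p146425) and are now one-line references to the landed theorems; the
losslessness of the line is landed too (`…Attainment.lean`, p146593:
`groundStateVarianceCertificate_iff_attained_and_dominated`, and
`stubPeriodicMinimiser_iff_crysPeriodicMinAttained` = item stmt-AtomisticToContinuum-0627), and the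
a-priori certificate with SOME constant (`exists_weak_certificate`, p149467). Remaining `sorry`s:
`stub_periodicMinimiser` (= open item 0627) and `stub_coreDomination` (the open core).

v4 (lead c2, reshape): Cauchy–Schwarz per site (`Σ s² ≤ (N-1) Σ t` for EVERY configuration, landed
`…CauchySchwarz.lean` p150873, `certificate_of_le_thirteen`) makes the certificate free for `N ≤ 13`
with the certified constant `12 = -24·e(fcc, a = 1)`; the by-particle-number split is therefore
`N ≤ 13` (closed, no ground-state input) / `N ≥ 14` (the core, re-registered with `14 ≤ N`). The
geometric `N ≤ 4` stub stays landed but is no longer on the critical path. The crux is EXACTLY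
attainment ∧ core (`groundStateVarianceCertificate_iff_attained_and_core`, `…CoreReductions.lean`
p150488, stated there for the v3 core `5 ≤ N`; the v4 core implies the v3 core's conclusion for
`N ≥ 14` and `certificate_of_le_thirteen` covers `5 ≤ N ≤ 13`, see `coreDomination_five_of_fourteen`).

Route `PRVarianceCertificate` (route-AtomisticToContinuum-PRVarianceCertificate), crux rank 2:

  `∃ P C, 0 < C ∧ e_LJ(P) ≤ -C/24 ∧ ∀ LJ ground states x, Σ_i s_i(x)² ≤ C · Σ_i t_i(x)`

with `s_i = siteEnergy (r ↦ r⁻⁶) x i`, `t_i = siteEnergy (r ↦ r⁻¹²) x i`.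

## The line (unchanged composition): sharp-constant normal form = attainment × periodic domination

By the landed supports of the route (`CertificateBoundsEnergy`, `CrysEnergyUpper`,
`CrysPeriodicBddBelow`) any witness `(P, C)` of the crux has `C = -24·e(P)` and `e(P) = e⋆ :=
inf_Q e(Q)`. So the crux factors into ATTAINMENT (`stub_periodicMinimiser`) and PERIODIC
DOMINATION of the ground-state quotient (`periodicDomination_of_stubs`, formerly the single stub
`stub_periodicDomination`).

## Reshape v2 (lead c1, 2026-08-17): domination split by particle number

The domination statement `∀ N x, IsGroundState x → ∃ Q, Σ s² ≤ (-24 e(Q)) Σ t` is now assembled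
(sorry-free, `periodicDomination_of_stubs`) from three registered stubs:

* `stub_virialSite` — the VIRIAL IDENTITY in site form, `Σ_i t_i = Σ_i s_i` for every Lennard-Jones
  ground state (zero pressure: `c ↦ 𝓔(c·x)` is minimal at `c = 1`; the pair form
  `Σ_{i<j} r⁻¹² = Σ_{i<j} r⁻⁶` is in the tree, `LjLaminarWindowsSketch.virial_sum_inv_pow_eq`).
  Provable now.
* `stub_smallClusters` — SMALL CLUSTERS: for `N ≤ 4` every Lennard-Jones ground state in `ℝ³` is a
  unit simplex (all `r_ij = 1`, since `V_LJ ≥ -1/12` with equality iff `r = 1` and the regular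
  simplex of side `1` embeds in `ℝ³` for `N ≤ 4`), so `s_i = t_i = N - 1` and `Σ s² ≤ 3·Σ t`.
  Provable now.
* `stub_coreDomination` — the OPEN CORE: for `N ≥ 5` and a ground state `x` in virial balance
  (`Σ t = Σ s`, supplied by `stub_virialSite`) some periodic `Q` has `Σ s² ≤ (-24 e(Q))·Σ t`, i.e.
  the `s`-weighted mean of the `r⁻⁶`-coordinations `s_i` is at most `-24·e(Q)`. This is the
  certificate proper (sharp constant `Φ⋆ = -24 e⋆ ≈ 17.22`); the lead holds it.

Small clusters are dominated by the tree's certified negative periodic energy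
`e(fcc, a = 1) ≤ -1/2` (`-24·e ≥ 12 ≥ 3`). The final assembly `GroundStateVarianceCertificate_of_stubs`
(attainment + domination ⇒ crux verbatim) is the birth skeleton's, byte-identical in content.

Disproof used: none filed for this crux (`ledger crux ls` shows no `Disproof.lean`, 2026-08-17).
-/

namespace Summit.AtomisticToContinuum.Crystallization.Cruxes.GroundStateVarianceCertificate.Birth

open Literature.MathematicalPhysics.StatisticalMechanics

/-! ## The declared stubs (the only `sorry`s of the file) -/

/-- **Stub 1 (attainment of the periodic Lennard-Jones minimum).** Some periodic configuration
`P` of `ℝ³` minimises the Lennard-Jones energy per particle among ALL periodic configurations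
(every full-rank lattice, every finite motif). Intended witness: relaxed hcp (`Φ(hcp) = 17.2222`
vs `Φ(fcc) = 17.2204`), but the stub leaves the stacking selection open. Up to unfolding `IsLeast`
this is the shared open item stmt-AtomisticToContinuum-0627 `CrysPeriodicMinAttained`. [conjecture] -/
theorem stub_periodicMinimiser :
    ∃ P : PeriodicConfiguration 3, ∀ Q : PeriodicConfiguration 3,
      P.energyPerParticle lennardJones ≤ Q.energyPerParticle lennardJones := by
  sorry

/-- **Stub 2a (virial identity, site form).** In every finite Lennard-Jones ground state the total
`r⁻¹²`-site energy equals the total `r⁻⁶`-site energy, `Σ_i t_i = Σ_i s_i` (zero pressure: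
dilations are competitors, so `c ↦ 𝓔(c x)` is stationary at `c = 1`). [folklore] -/
theorem stub_virialSite :
    ∀ (N : ℕ) (x : Fin N → EuclideanSpace ℝ (Fin 3)), IsGroundState lennardJones x →
      ∑ i, siteEnergy (fun r => (r⁻¹) ^ 12) x i = ∑ i, siteEnergy (fun r => (r⁻¹) ^ 6) x i :=
  -- LANDED (p146341): Theorems/PRVarianceCertificateGroundStateVarianceCertificateStubVirialSite.lean
  _root_.Summit.AtomisticToContinuum.Crystallization.Theorems.GroundStateVarianceCertificateLine.stub_virialSite

/-- **Stub 2b (small clusters).** For `N ≤ 4` particles every Lennard-Jones ground state in `ℝ³`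
is a unit simplex (all mutual distances `1`), whence `s_i = t_i = N - 1` and
`Σ_i s_i² = N (N-1)² ≤ 3 · N (N-1) = 3 · Σ_i t_i`. [folklore] -/
theorem stub_smallClusters :
    ∀ (N : ℕ) (x : Fin N → EuclideanSpace ℝ (Fin 3)), N ≤ 4 → IsGroundState lennardJones x →
      ∑ i, (siteEnergy (fun r => (r⁻¹) ^ 6) x i) ^ 2 ≤
        3 * ∑ i, siteEnergy (fun r => (r⁻¹) ^ 12) x i :=
  -- LANDED (p146425): Theorems/PRVarianceCertificateGroundStateVarianceCertificateStubSmallClusters.lean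
  _root_.Summit.AtomisticToContinuum.Crystallization.Theorems.GroundStateVarianceCertificateLine.stub_smallClusters

/-- **Stub 2c (core: periodic domination of large ground states in virial balance).** For every
Lennard-Jones ground state `x` of `N ≥ 14` particles with `Σ_i t_i = Σ_i s_i` there is a periodic
configuration `Q` of `ℝ³` whose scale-free constant `-24·e(Q)` dominates the variance-form
quotient: `Σ_i s_i² ≤ (-24·e(Q)) · Σ_i t_i` — equivalently the `s`-weighted mean of the
`r⁻⁶`-coordinations `s_i` is at most `-24·e(Q)`. This is the certificate proper (sharp constant
`Φ⋆ = -24·inf_Q e(Q) ≈ 17.22`, intended `Q` = relaxed hcp). [conjecture] -/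
theorem stub_coreDomination :
    ∀ (N : ℕ) (x : Fin N → EuclideanSpace ℝ (Fin 3)), 14 ≤ N → IsGroundState lennardJones x →
      ∑ i, siteEnergy (fun r => (r⁻¹) ^ 12) x i = ∑ i, siteEnergy (fun r => (r⁻¹) ^ 6) x i →
      ∃ Q : PeriodicConfiguration 3,
        ∑ i, (siteEnergy (fun r => (r⁻¹) ^ 6) x i) ^ 2 ≤
          (-24 * Q.energyPerParticle lennardJones) * ∑ i, siteEnergy (fun r => (r⁻¹) ^ 12) x i := by
  sorry

/-- **Few particles (v4, LANDED p150873): the certificate is free for `N ≤ 13`.** Cauchy–Schwarz per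
site gives `Σ_i s_i² ≤ (N-1) Σ_i t_i` for every configuration, so `Σ s² ≤ 12 Σ t` for `N ≤ 13`
(no ground-state input). [folklore] -/
theorem fewParticles :
    ∀ (N : ℕ) (x : Fin N → EuclideanSpace ℝ (Fin 3)), N ≤ 13 →
      ∑ i, (siteEnergy (fun r => (r⁻¹) ^ 6) x i) ^ 2 ≤
        12 * ∑ i, siteEnergy (fun r => (r⁻¹) ^ 12) x i :=
  _root_.Summit.AtomisticToContinuum.Crystallization.Theorems.GroundStateVarianceCertificateLine.certificate_of_le_thirteen

/-- **Bridge v4 → v3 (sorry-free modulo the v4 core).** The v3 core (`5 ≤ N`) from the v4 core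
(`14 ≤ N`) and the free range `N ≤ 13` (dominated by fcc at nearest-neighbour distance `1`,
`-24 e ≥ 12`). [folklore] -/
theorem coreDomination_five_of_fourteen
    (hcore : ∀ (N : ℕ) (x : Fin N → EuclideanSpace ℝ (Fin 3)), 14 ≤ N → IsGroundState lennardJones x →
      ∑ i, siteEnergy (fun r => (r⁻¹) ^ 12) x i = ∑ i, siteEnergy (fun r => (r⁻¹) ^ 6) x i →
      ∃ Q : PeriodicConfiguration 3,
        ∑ i, (siteEnergy (fun r => (r⁻¹) ^ 6) x i) ^ 2 ≤
          (-24 * Q.energyPerParticle lennardJones) * ∑ i, siteEnergy (fun r => (r⁻¹) ^ 12) x i) :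
    ∀ (N : ℕ) (x : Fin N → EuclideanSpace ℝ (Fin 3)), 5 ≤ N → IsGroundState lennardJones x →
      ∑ i, siteEnergy (fun r => (r⁻¹) ^ 12) x i = ∑ i, siteEnergy (fun r => (r⁻¹) ^ 6) x i →
      ∃ Q : PeriodicConfiguration 3,
        ∑ i, (siteEnergy (fun r => (r⁻¹) ^ 6) x i) ^ 2 ≤
          (-24 * Q.energyPerParticle lennardJones) * ∑ i, siteEnergy (fun r => (r⁻¹) ^ 12) x i := by
  intro N x _ hx hvir
  rcases Nat.lt_or_ge 13 N with hN | hN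
  · exact hcore N x (by omega) hx hvir
  · refine ⟨_root_.Summit.AtomisticToContinuum.Crystallization.Theorems.LayeredLawsSelectHcp.Negative.FccEnergy.fccPC
      one_ne_zero, (fewParticles N x hN).trans ?_⟩
    have ht : 0 ≤ ∑ i, siteEnergy (fun r => (r⁻¹) ^ 12) x i := by
      refine Finset.sum_nonneg fun i _ => ?_
      unfold siteEnergy
      exact Finset.sum_nonneg fun k _ => by positivity
    have he := _root_.Summit.AtomisticToContinuum.Crystallization.Theorems.LayeredLawsSelectHcp.Negative.Threshold.energyPerParticle_fccPC_one_le
    exact mul_le_mul_of_nonneg_right (by linarith) ht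

/-! ## The assembly (sorry-free) -/

/-- **Domination from stubs 2a–2c (sorry-free).** Every finite Lennard-Jones ground state admits a
periodic competitor `Q` with `Σ s² ≤ (-24 e(Q)) Σ t`: for `N ≤ 4` take `Q` = fcc at nearest-neighbour
distance `1`, whose certified energy `e ≤ -1/2` gives `-24 e ≥ 12 ≥ 3` (and `Σ t ≥ 0`); for `N ≥ 5`
the core stub applies, the virial balance being supplied by stub 2a. [folklore] -/
theorem periodicDomination_of_stubs
    (hvir : ∀ (N : ℕ) (x : Fin N → EuclideanSpace ℝ (Fin 3)), IsGroundState lennardJones x →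
      ∑ i, siteEnergy (fun r => (r⁻¹) ^ 12) x i = ∑ i, siteEnergy (fun r => (r⁻¹) ^ 6) x i)
    (hsmall : ∀ (N : ℕ) (x : Fin N → EuclideanSpace ℝ (Fin 3)), N ≤ 4 → IsGroundState lennardJones x →
      ∑ i, (siteEnergy (fun r => (r⁻¹) ^ 6) x i) ^ 2 ≤
        3 * ∑ i, siteEnergy (fun r => (r⁻¹) ^ 12) x i)
    (hcore : ∀ (N : ℕ) (x : Fin N → EuclideanSpace ℝ (Fin 3)), 5 ≤ N → IsGroundState lennardJones x →
      ∑ i, siteEnergy (fun r => (r⁻¹) ^ 12) x i = ∑ i, siteEnergy (fun r => (r⁻¹) ^ 6) x i →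
      ∃ Q : PeriodicConfiguration 3,
        ∑ i, (siteEnergy (fun r => (r⁻¹) ^ 6) x i) ^ 2 ≤
          (-24 * Q.energyPerParticle lennardJones) * ∑ i, siteEnergy (fun r => (r⁻¹) ^ 12) x i) :
    ∀ (N : ℕ) (x : Fin N → EuclideanSpace ℝ (Fin 3)), IsGroundState lennardJones x →
      ∃ Q : PeriodicConfiguration 3,
        ∑ i, (siteEnergy (fun r => (r⁻¹) ^ 6) x i) ^ 2 ≤
          (-24 * Q.energyPerParticle lennardJones) * ∑ i, siteEnergy (fun r => (r⁻¹) ^ 12) x i := by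
  intro N x hx
  rcases Nat.lt_or_ge 4 N with hN | hN
  · -- large clusters: the core stub, with the virial balance supplied by stub 2a
    exact hcore N x (by omega) hx (hvir N x hx)
  · -- small clusters: dominated by fcc at nearest-neighbour distance 1
    refine ⟨_root_.Summit.AtomisticToContinuum.Crystallization.Theorems.LayeredLawsSelectHcp.Negative.FccEnergy.fccPC
      one_ne_zero, (hsmall N x hN hx).trans ?_⟩
    have ht : 0 ≤ ∑ i, siteEnergy (fun r => (r⁻¹) ^ 12) x i := by
      refine Finset.sum_nonneg fun i _ => ?_
      unfold siteEnergy
      exact Finset.sum_nonneg fun k _ => by positivity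
    have he := _root_.Summit.AtomisticToContinuum.Crystallization.Theorems.LayeredLawsSelectHcp.Negative.Threshold.energyPerParticle_fccPC_one_le
    exact mul_le_mul_of_nonneg_right (by linarith) ht

/-- **Assembly, hypothesis form (sorry-free).** Attainment and periodic domination give the crux
statement — written out verbatim (it is `GroundStateVarianceCertificate` unfolded; see the
`example` below) — with `P` the periodic minimiser and `C = -24·e(P)`: positivity of `C` from the
certified negative periodic energy `e(fcc, a = 1) ≤ -1/2` (tree), `e(P) ≤ -C/24` with equality,
and `Σ s² ≤ (-24 e(Q)) Σ t ≤ (-24 e(P)) Σ t` by minimality of `P` and `Σ t ≥ 0`. [folklore] -/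
theorem GroundStateVarianceCertificate_of_stubs
    (hmin : ∃ P : PeriodicConfiguration 3, ∀ Q : PeriodicConfiguration 3,
      P.energyPerParticle lennardJones ≤ Q.energyPerParticle lennardJones)
    (hdom : ∀ (N : ℕ) (x : Fin N → EuclideanSpace ℝ (Fin 3)), IsGroundState lennardJones x →
      ∃ Q : PeriodicConfiguration 3,
        ∑ i, (siteEnergy (fun r => (r⁻¹) ^ 6) x i) ^ 2 ≤
          (-24 * Q.energyPerParticle lennardJones) * ∑ i, siteEnergy (fun r => (r⁻¹) ^ 12) x i) :
    ∃ (P : Literature.MathematicalPhysics.StatisticalMechanics.PeriodicConfiguration 3) (C : ℝ), 0 < C ∧ P.energyPerParticle Literature.MathematicalPhysics.StatisticalMechanics.lennardJones ≤ -(C / 24) ∧ ∀ (N : ℕ) (x : Fin N → EuclideanSpace ℝ (Fin 3)), Literature.MathematicalPhysics.StatisticalMechanics.IsGroundState Literature.MathematicalPhysics.StatisticalMechanics.lennardJones x → ∑ i, (Literature.MathematicalPhysics.StatisticalMechanics.siteEnergy (fun r => (r⁻¹) ^ 6) x i) ^ 2 ≤ C * ∑ i, Literature.MathematicalPhysics.StatisticalMechanics.siteEnergy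 (fun r => (r⁻¹) ^ 12) x i := by
  obtain ⟨P, hmin⟩ := hmin
  -- the periodic minimum is negative: e(P) ≤ e(fcc at nearest-neighbour distance 1) ≤ -1/2 < 0
  have hneg : P.energyPerParticle lennardJones < 0 :=
    lt_of_le_of_lt ((hmin _).trans
      _root_.Summit.AtomisticToContinuum.Crystallization.Theorems.LayeredLawsSelectHcp.Negative.Threshold.energyPerParticle_fccPC_one_le)
      (by norm_num)
  refine ⟨P, -24 * P.energyPerParticle lennardJones, by linarith, le_of_eq (by ring), ?_⟩
  intro N x hx
  obtain ⟨Q, hQ⟩ := hdom N x hx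
  -- Σ_i t_i ≥ 0 (sums of twelfth powers of inverse distances)
  have ht : 0 ≤ ∑ i, siteEnergy (fun r => (r⁻¹) ^ 12) x i := by
    refine Finset.sum_nonneg fun i _ => ?_
    unfold siteEnergy
    exact Finset.sum_nonneg fun k _ => by positivity
  calc ∑ i, (siteEnergy (fun r => (r⁻¹) ^ 6) x i) ^ 2
      ≤ (-24 * Q.energyPerParticle lennardJones) * ∑ i, siteEnergy (fun r => (r⁻¹) ^ 12) x i := hQ
    _ ≤ (-24 * P.energyPerParticle lennardJones) * ∑ i, siteEnergy (fun r => (r⁻¹) ^ 12) x i :=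
      mul_le_mul_of_nonneg_right (by linarith [hmin Q]) ht

/-- The hypothesis form concludes the route's crux decl itself (by `rfl`-unfolding): the shape
`stub₁-sig → domination-sig → GroundStateVarianceCertificate`, sorry-free. [folklore] -/
example :
    (∃ P : PeriodicConfiguration 3, ∀ Q : PeriodicConfiguration 3,
      P.energyPerParticle lennardJones ≤ Q.energyPerParticle lennardJones) →
    (∀ (N : ℕ) (x : Fin N → EuclideanSpace ℝ (Fin 3)), IsGroundState lennardJones x →
      ∃ Q : PeriodicConfiguration 3,
        ∑ i, (siteEnergy (fun r => (r⁻¹) ^ 6) x i) ^ 2 ≤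
          (-24 * Q.energyPerParticle lennardJones) * ∑ i, siteEnergy (fun r => (r⁻¹) ^ 12) x i) →
    Summit.AtomisticToContinuum.Crystallization.Theses.PRVarianceCertificate.GroundStateVarianceCertificate :=
  GroundStateVarianceCertificate_of_stubs

/-! ## The registered skeleton theorem: the crux BY NAME from the declared stubs -/

/-- **Skeleton.** The crux `PRVarianceCertificate.GroundStateVarianceCertificate` from the four
declared stubs `stub_periodicMinimiser`, `stub_virialSite`, `stub_smallClusters`,
`stub_coreDomination` (v4: `14 ≤ N`, bridged to `5 ≤ N` by `coreDomination_five_of_fourteen`)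
through the sorry-free assemblies `periodicDomination_of_stubs` and
`GroundStateVarianceCertificate_of_stubs`; `sorry` enters only through the two open stubs
`stub_periodicMinimiser` (= item 0627) and `stub_coreDomination`. [conjecture] -/
theorem GroundStateVarianceCertificate_of :
    Summit.AtomisticToContinuum.Crystallization.Theses.PRVarianceCertificate.GroundStateVarianceCertificate :=
  GroundStateVarianceCertificate_of_stubs stub_periodicMinimiser
    (periodicDomination_of_stubs stub_virialSite stub_smallClusters
      (coreDomination_five_of_fourteen stub_coreDomination))

end Summit.AtomisticToContinuum.Crystallization.Cruxes.GroundStateVarianceCertificate.Birth
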